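import Summits.QuantumFields.YangMills.Theorems.IR.BlockedActivityWTilt
import HarnessLib

/-!
# Crux `IR` (stmt-QuantumFields-19354), lane B «strong coupling AFTER BLOCKING»: the W-class of record from centre-cell RATIO mixing
# (dictionary, every `β`) — conditioning the change-of-exterior tilt on the centre cell

Helper module for item `stmt-QuantumFields-19354` (`--supports`; it closes nothing), lane `ym-19354-onsetsc-p2` (g3); part 2∕2 of the
dictionary (part 1: `Theorems/IR/BlockedActivityWTilt` — the single-cell tilt representation `blockedRepOn_of_tilt` and the change-of-exterior
identity `integral_ymSpecification_eq_div_bcRatio`).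

WHAT IS HERE (all proved).
* `centreRatio ρ β w Y σ τ` — the boundary Boltzmann ratio `bcRatio ρ β Λ σ τ` (`Λ = regionEdges w Y`) averaged under the INNER kernel
  (links of `Λ` off the centre cell resampled) with exterior «`U` on `Λ`, `τ` off `Λ`»: a function of the centre links only; up to
  normalisation the density of the centre-cell marginal of `γ_Λ(·|σ)` against that of `γ_Λ(·|τ)`.
* `integral_eq_div_centreRatio` — `∫ f dγ_Λ(·|σ) = ∫ f·q dγ_Λ(·|τ) ∕ ∫ q dγ_Λ(·|τ)` for every centre observable `f` and EVERY pair of exteriors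
  (change of exterior, then the Markov property of the Wilson specification — tree `integral_mul_eq_integral_mul_kernel` — then properness).
* **`blockedRepOn_of_centreRatio_le`** ∕ **`blockedActivityClassW_of_centreRatio_le`** — a multiplicative oscillation bound
  `q_σ(U) ≤ e^{A} q_σ(U')` for the data `σ ∈ S` gives `BlockedRepOn ρ β w Y (e^{A} − 1) S`; uniformly over frames ∕ regions ∕ window data it
  gives the class of record `BlockedActivityClassW ρ β b n (e^{A} − 1)`.  So the W-class is SANDWICHED between two mixing statements for the
  centre cell over the agreement class: RATIO mixing (this file) ⇒ class W ⇒ total-variation mixing `UnivShellCond` (`univShellCond_of_blockedActivityW`,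
  p536391 ∕ p538158).  The strong-coupling instance at EVERY mesh is `Theorems/IR/BlockedActivityWStrongCouplingMesh`.

HONEST FRAMING: a format theorem about the lane's own currency (every `β`, every compact `G`); nothing here asserts weak-coupling mixing,
a gap or Clay.  No `sorry`; axioms ⊆ {propext, Classical.choice, Quot.sound}; no instances, no notation.
Refs: Georgii 2011 Def. 1.23 (iii) (consistency), proof of Prop. 8.8; Chatterjee CMP 385 (2021) §7 Lemma 7.3; Dobrushin–Shlosman 1987
(ratio-mixing conditions of complete analyticity).
-/

set_option autoImplicit false

noncomputable section

open MeasureTheory ProbabilityTheory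
open Literature.MathematicalPhysics.QuantumLattice
open Literature.Probability.LatticeModels
open Summit.QuantumFields.YangMills.Cruxes.IR.Tempered (cellEdges windowCells regionEdges collarEdges)

namespace Summit.QuantumFields.YangMills.Cruxes.IR.BlockedActivity

/-! ## §3 Conditioning the tilt on the centre cell: the W-class from centre-cell RATIO mixing -/

section CentreRatio

variable {G : Type} [Group G] [TopologicalSpace G] [IsTopologicalGroup G] [CompactSpace G]
  [MeasurableSpace G] [BorelSpace G] {N : ℕ} (ρ : G →* Matrix (Fin N) (Fin N) ℂ)

/-- The inner volume: the region's links minus the centre cell's. -/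
def innerEdges (w : Fin 4 → ℤ → ℤ) (Y : Finset Cell) : Finset (ZdEdge 4) := regionEdges w Y \ cellEdges w 0

/-- **The centre-conditioned boundary ratio** `q_{σ,τ}(U)`: the average of the boundary Boltzmann ratio `bcRatio ρ β Λ σ τ`
(`Λ = regionEdges w Y`) under the INNER kernel (links of `Λ` off the centre cell resampled) with exterior «`U` on `Λ`, `τ` off `Λ`» —
a function of the centre links of `U` only (`centreRatio_eq_of_eqOn`).  Up to normalisation it is the density of the centre-cell
marginal of `γ_Λ(·|σ)` against that of `γ_Λ(·|τ)` (`integral_eq_div_centreRatio`). -/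
def centreRatio (β : ℝ) (w : Fin 4 → ℤ → ℤ) (Y : Finset Cell) (σ τ : LGConfig 4 G) (U : LGConfig 4 G) : ℝ :=
  ∫ V, bcRatio ρ β (regionEdges w Y) σ τ V
    ∂(ymSpecification ρ β (innerEdges w Y) (splice (regionEdges w Y) U τ))

variable {ρ}

omit [TopologicalSpace G] [IsTopologicalGroup G] [CompactSpace G] [MeasurableSpace G] [BorelSpace G] in
/-- The inner volume lies in the region. -/
theorem innerEdges_subset (w : Fin 4 → ℤ → ℤ) (Y : Finset Cell) : innerEdges w Y ⊆ regionEdges w Y := Finset.sdiff_subset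

omit [TopologicalSpace G] [IsTopologicalGroup G] [CompactSpace G] [MeasurableSpace G] [BorelSpace G] in
/-- Centre links are not inner links. -/
theorem not_mem_innerEdges_of_mem_cellEdges (w : Fin 4 → ℤ → ℤ) (Y : Finset Cell) {e : ZdEdge 4} (he : e ∈ cellEdges w 0) :
    e ∉ innerEdges w Y := fun h => (Finset.mem_sdiff.1 h).2 he

/-- The centre-conditioned ratio is positive. -/
theorem centreRatio_pos [T2Space G] [SecondCountableTopology G] (hρ : Continuous ρ) (β : ℝ) (w : Fin 4 → ℤ → ℤ) (Y : Finset Cell)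
    (σ τ U : LGConfig 4 G) : 0 < centreRatio ρ β w Y σ τ U := by
  have hγ := Literature.MathematicalPhysics.QuantumFieldTheory.isSpecification_ymSpecification_of_t2Space (d := 4) ρ hρ β
  haveI := hγ.isProbability (innerEdges w Y) (splice (regionEdges w Y) U τ)
  unfold centreRatio bcRatio
  refine integral_exp_pos (integrable_exp_of_abs_le _ ?_ ?_)
  · exact (continuous_const.mul (((continuous_wilsonBoundaryAction ρ hρ _).comp (continuous_splice _ σ)).sub
      ((continuous_wilsonBoundaryAction ρ hρ _).comp (continuous_splice _ τ)))).measurable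
  · exact exists_bound_of_continuous (continuous_const.mul (((continuous_wilsonBoundaryAction ρ hρ _).comp
      (continuous_splice _ σ)).sub ((continuous_wilsonBoundaryAction ρ hρ _).comp (continuous_splice _ τ))))

/-- The centre-conditioned ratio is measurable (kernel measurability, Mathlib `StronglyMeasurable.integral_kernel`). -/
theorem measurable_centreRatio [T2Space G] [SecondCountableTopology G] (hρ : Continuous ρ) (β : ℝ) (w : Fin 4 → ℤ → ℤ)
    (Y : Finset Cell) (σ τ : LGConfig 4 G) : Measurable (centreRatio ρ β w Y σ τ) := by
  have hγ := Literature.MathematicalPhysics.QuantumFieldTheory.isSpecification_ymSpecification_of_t2Space (d := 4) ρ hρ β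
  let κ : Kernel (LGConfig 4 G) (LGConfig 4 G) := ⟨ymSpecification ρ β (innerEdges w Y), hγ.measurable_fun _⟩
  have h : Measurable fun η : LGConfig 4 G => ∫ V, bcRatio ρ β (regionEdges w Y) σ τ V ∂(ymSpecification ρ β (innerEdges w Y) η) :=
    ((measurable_bcRatio ρ hρ β _ σ τ).stronglyMeasurable.integral_kernel (κ := κ)).measurable
  exact h.comp (measurable_splice _ τ)

/-- The centre-conditioned ratio reads only the centre links (indeed only the links of the region; off the inner volume the exterior
is «`U` on the centre cell, `τ` elsewhere»). -/
theorem centreRatio_eq_of_eqOn (β : ℝ) (w : Fin 4 → ℤ → ℤ) (Y : Finset Cell) (σ τ : LGConfig 4 G) {U U' : LGConfig 4 G}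
    (h : ∀ e ∈ regionEdges w Y, U e = U' e) : centreRatio ρ β w Y σ τ U = centreRatio ρ β w Y σ τ U' := by
  simp only [centreRatio, splice_eq_of_eqOn _ τ h]

/-- **Conditioning the tilt on the centre cell.**  For every centre observable `f` and every pair of exteriors `σ, τ`:
`∫ f dγ_Λ(·|σ) = ∫ f·q dγ_Λ(·|τ) ∕ ∫ q dγ_Λ(·|τ)`, `q = centreRatio ρ β w Y σ τ`, `Λ = regionEdges w Y` (change of exterior, §2, then the Markov
property of the Wilson specification — tree `integral_mul_eq_integral_mul_kernel` — for the inner volume, then properness). -/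
theorem integral_eq_div_centreRatio [T2Space G] [SecondCountableTopology G] (hρ : Continuous ρ) (β : ℝ) (w : Fin 4 → ℤ → ℤ)
    {Y : Finset Cell} (h0 : (0 : Cell) ∈ Y) (σ τ : LGConfig 4 G) {f : LGConfig 4 G → ℝ} (hf : IsCentreObs w f) :
    ∫ U, f U ∂(ymSpecification ρ β (regionEdges w Y) σ) =
      (∫ U, f U * centreRatio ρ β w Y σ τ U ∂(ymSpecification ρ β (regionEdges w Y) τ)) /
        ∫ U, centreRatio ρ β w Y σ τ U ∂(ymSpecification ρ β (regionEdges w Y) τ) := by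
  have hγ := Literature.MathematicalPhysics.QuantumFieldTheory.isSpecification_ymSpecification_of_t2Space (d := 4) ρ hρ β
  set Λ := regionEdges w Y with hΛ
  haveI := hγ.isProbability Λ τ
  have hE0 : cellEdges w 0 ⊆ Λ := Tempered.cellEdges_subset_regionEdges w h0
  -- step 1: change of exterior
  have hFg : ∀ u : ↥Λ → G, f (glueWith Λ u σ) = f (glueWith Λ u τ) := fun u =>
    hf.1 fun e he => by
      rw [glueWith_apply_mem _ _ _ (hE0 he), glueWith_apply_mem _ _ _ (hE0 he)]
  rw [integral_ymSpecification_eq_div_bcRatio ρ hρ β Λ σ τ hf.2.1 hFg]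
  -- step 2: the Markov property for the inner volume
  have hsub : innerEdges w Y ⊆ Λ := innerEdges_subset w Y
  have hfdep : DependsOn f ((↑(innerEdges w Y) : Set (ZdEdge 4))ᶜ) := fun U V hUV =>
    hf.1 fun e he => hUV e fun h => not_mem_innerEdges_of_mem_cellEdges w Y (Finset.mem_coe.1 he) (Finset.mem_coe.1 h)
  have hfb : ∃ B, ∀ U, |f U| ≤ B := ⟨1, fun U => abs_le.2 ⟨by linarith [(hf.2.2 U).1], (hf.2.2 U).2⟩⟩
  have hRm := measurable_bcRatio ρ hρ β Λ σ τ
  have hRb := exists_bcRatio_le ρ hρ β Λ σ τ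
  have hnum := integral_mul_eq_integral_mul_kernel ρ hρ β hsub τ hf.2.1 hfb hfdep hRm hRb
  have hden := integral_mul_eq_integral_mul_kernel ρ hρ β hsub τ (f := fun _ => (1 : ℝ)) measurable_const ⟨1, fun _ => by simp⟩
    (fun _ _ _ => rfl) hRm hRb
  simp only [one_mul] at hden
  rw [hnum, hden]
  -- step 3: properness — under `γ_Λ(·|τ)` the exterior of the inner kernel is the splice
  have hae : ∀ᵐ U ∂(ymSpecification ρ β Λ τ), splice Λ U τ = U := by
    filter_upwards [hγ.proper Λ τ] with U hU
    exact splice_eq_self Λ hU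
  have h1 : ∫ U, f U * (∫ V, bcRatio ρ β Λ σ τ V ∂(ymSpecification ρ β (innerEdges w Y) U)) ∂(ymSpecification ρ β Λ τ) =
      ∫ U, f U * centreRatio ρ β w Y σ τ U ∂(ymSpecification ρ β Λ τ) := by
    refine integral_congr_ae ?_
    filter_upwards [hae] with U hU
    simp only [centreRatio, ← hΛ, hU]
  have h2 : ∫ U, (∫ V, bcRatio ρ β Λ σ τ V ∂(ymSpecification ρ β (innerEdges w Y) U)) ∂(ymSpecification ρ β Λ τ) =
      ∫ U, centreRatio ρ β w Y σ τ U ∂(ymSpecification ρ β Λ τ) := by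
    refine integral_congr_ae ?_
    filter_upwards [hae] with U hU
    simp only [centreRatio, ← hΛ, hU]
  rw [h1, h2]

/-- If `e^{A} + e^{−A} ≥ 2`-type bookkeeping: a ratio in `[e^{−A}, e^{A}]` is within `e^{A} − 1` of `1`. -/
theorem abs_sub_one_le_of_ratio {x A : ℝ} (h1 : x ≤ Real.exp A) (h2 : Real.exp (-A) ≤ x) : |x - 1| ≤ Real.exp A - 1 := by
  rw [abs_le]
  constructor
  · have := Real.add_one_le_exp A
    have := Real.add_one_le_exp (-A)
    linarith
  · linarith

/-- **The W-class from centre-cell RATIO mixing (dictionary, every `β`).**  If for every datum `σ ∈ S` the centre-conditioned ratio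
oscillates multiplicatively by at most `e^{A}` — `centreRatio ρ β w Y σ τ U ≤ e^{A} · centreRatio ρ β w Y σ τ U'` for all `U, U'` — then
`BlockedRepOn ρ β w Y (e^{A} − 1) S`: the single-cell tilt representation on the kernel `γ_Λ(·|τ)` itself with `ψ_σ = q_σ ∕ ∫ q_σ dγ_Λ(·|τ)`. -/
theorem blockedRepOn_of_centreRatio_le [T2Space G] [SecondCountableTopology G] (hρ : Continuous ρ) {β : ℝ} {w : Fin 4 → ℤ → ℤ}
    {Y : Finset Cell} (h0 : (0 : Cell) ∈ Y) (τ : LGConfig 4 G) {S : Set (LGConfig 4 G)} {A : ℝ} (hA : 0 ≤ A)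
    (hratio : ∀ σ ∈ S, ∀ U U', centreRatio ρ β w Y σ τ U ≤ Real.exp A * centreRatio ρ β w Y σ τ U') :
    Nonempty (BlockedRepOn ρ β w Y (Real.exp A - 1) S) := by
  have hγ := Literature.MathematicalPhysics.QuantumFieldTheory.isSpecification_ymSpecification_of_t2Space (d := 4) ρ hρ β
  set Λ := regionEdges w Y with hΛ
  haveI := hγ.isProbability Λ τ
  set μ := ymSpecification ρ β Λ τ with hμ
  -- the normalised tilt
  set m : LGConfig 4 G → ℝ := fun σ => ∫ U, centreRatio ρ β w Y σ τ U ∂μ with hm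
  have hqm : ∀ σ, Measurable (centreRatio ρ β w Y σ τ) := fun σ => measurable_centreRatio hρ β w Y σ τ
  have hqb : ∀ σ, ∃ B, ∀ U, |centreRatio ρ β w Y σ τ U| ≤ B := fun σ => by
    obtain ⟨B, hB⟩ := exists_bcRatio_le ρ hρ β Λ σ τ
    refine ⟨B, fun U => ?_⟩
    haveI := hγ.isProbability (innerEdges w Y) (splice Λ U τ)
    have h := norm_integral_le_of_norm_le_const (μ := ymSpecification ρ β (innerEdges w Y) (splice Λ U τ))
      (f := bcRatio ρ β Λ σ τ) (C := B) (ae_of_all _ fun V => by rw [Real.norm_eq_abs]; exact hB V)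
    simpa [centreRatio, ← hΛ] using h
  have hqi : ∀ σ, Integrable (centreRatio ρ β w Y σ τ) μ := fun σ => by
    obtain ⟨B, hB⟩ := hqb σ
    exact Integrable.of_bound (hqm σ).aestronglyMeasurable B (ae_of_all _ fun U => by rw [Real.norm_eq_abs]; exact hB U)
  -- two-sided bounds `e^{-A} m ≤ q ≤ e^{A} m` for data in `S`
  have hup : ∀ σ ∈ S, ∀ U, centreRatio ρ β w Y σ τ U ≤ Real.exp A * m σ := fun σ hσ U => by
    have h : ∫ U', centreRatio ρ β w Y σ τ U ∂μ ≤ ∫ U', Real.exp A * centreRatio ρ β w Y σ τ U' ∂μ :=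
      integral_mono (integrable_const _) ((hqi σ).const_mul _) fun U' => hratio σ hσ U U'
    rw [integral_const, integral_const_mul] at h
    simpa using h
  have hlo : ∀ σ ∈ S, ∀ U, m σ ≤ Real.exp A * centreRatio ρ β w Y σ τ U := fun σ hσ U => by
    have h : ∫ U', centreRatio ρ β w Y σ τ U' ∂μ ≤ ∫ U', Real.exp A * centreRatio ρ β w Y σ τ U ∂μ :=
      integral_mono (hqi σ) (integrable_const _) fun U' => hratio σ hσ U' U
    rw [integral_const] at h
    simpa using h
  have hmpos : ∀ σ, 0 < m σ := fun σ => by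
    have h := integral_pos_iff_support_of_nonneg (μ := μ) (f := centreRatio ρ β w Y σ τ)
      (fun U => (centreRatio_pos hρ β w Y σ τ U).le) (hqi σ)
    rw [hm]; rw [h]
    have hsupp : Function.support (centreRatio ρ β w Y σ τ) = Set.univ :=
      Set.eq_univ_of_forall fun U => (centreRatio_pos hρ β w Y σ τ U).ne'
    rw [hsupp, measure_univ]; exact zero_lt_one
  refine ⟨blockedRepOn_of_tilt μ (fun σ U => centreRatio ρ β w Y σ τ U / m σ) (by linarith [Real.add_one_le_exp A])
    (fun σ _ => (hqm σ).div_const _) (fun σ hσ U => ?_) (fun σ _ f hf => ?_)⟩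
  · refine abs_sub_one_le_of_ratio ?_ ?_
    · rw [div_le_iff₀ (hmpos σ)]; exact hup σ hσ U
    · rw [le_div_iff₀ (hmpos σ), Real.exp_neg, inv_mul_le_iff₀ (Real.exp_pos A)]; exact hlo σ hσ U
  · rw [integral_eq_div_centreRatio hρ β w h0 σ τ hf]
    have hnum : ∫ U, f U * (centreRatio ρ β w Y σ τ U / m σ) ∂μ = (∫ U, f U * centreRatio ρ β w Y σ τ U ∂μ) / m σ := by
      rw [← integral_div]; refine integral_congr_ae (ae_of_all _ fun U => ?_); ring
    have hden : ∫ U, centreRatio ρ β w Y σ τ U / m σ ∂μ = (∫ U, centreRatio ρ β w Y σ τ U ∂μ) / m σ := integral_div _ _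
    rw [hnum, hden, div_div_div_cancel_right₀ (hmpos σ).ne']

/-- **Frame ∕ class form.**  A uniform multiplicative oscillation bound of the centre-conditioned ratio over the agreement classes of ALL
window data on every mesh-`b` frame gives the W-class of record with radius `e^{A} − 1`. -/
theorem blockedActivityClassW_of_centreRatio_le [T2Space G] [SecondCountableTopology G] (hρ : Continuous ρ) {β : ℝ} {b n : ℕ}
    {A : ℝ} (hA : 0 ≤ A)
    (hratio : ∀ w : Fin 4 → ℤ → ℤ, AfPincerUc.IsFrame b w → ∀ Y : Finset Cell, Y ⊆ windowCells n → (0 : Cell) ∈ Y →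
      ∀ τ σ : LGConfig 4 G, σ ∈ WindowAgree w n Y τ →
        ∀ U U', centreRatio ρ β w Y σ τ U ≤ Real.exp A * centreRatio ρ β w Y σ τ U') :
    BlockedActivityClassW ρ β b n (Real.exp A - 1) := fun w hw Y hY h0 τ =>
  blockedRepOn_of_centreRatio_le hρ h0 τ hA fun σ hσ => hratio w hw Y hY h0 τ σ hσ

end CentreRatio

end Summit.QuantumFields.YangMills.Cruxes.IR.BlockedActivity

end
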